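import Summits.ValiantsHypothesis.ValiantsHypothesis.Theorems.GrenetZeonDualUnipotentThreeHalvesLongMassCayleyTwist

/-!
# `GrenetZeon.DualUnipotentThreeHalves` (stmt-ValiantsHypothesis-24318), line `slow_core`, stub (c) `SlowCore.LongMassSlowLawInv`:
# MONOMIAL WALKS — a constructive LOWER bound on the window degree of a ledger direction (closed chains and helices)

The research stub (c) (⟺ `LongMassSlowLawAll`, ✓ `…LongMassIrreducibilityFree.inv_iff_all`) asks every nilpotent affine
`b × b` pencil `N` over the `n²` coordinates for a whole-pencil certificate `(K, k)` — `SlowCore.Ledger n b N ⊤ K k`: along every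
line `x + s·v`, `v ∈ K`, every power `p ≤ n − 1` of `N(x + s v) = N(x) + s·lin v` has entries of `s`-degree `≤ k` — of price
`n·k + codim K ≤ c·√n·b`.  The lower-side instruments in the tree are the INDEX SHADOW (✓ `LedgerIndex.linMat_pow_eq_zero_of_ledger`:
ledger directions have `(lin v)^{k+1} = 0`) and, for torus-equivariant pencils, the coordinate count (✓ `LedgerTorus.not_relCert_of_count`).

This file adds a sharper, pencil-agnostic lower bound that sees the POINT VALUES `A = N(x)` and not only the linear part
`B = lin v`: a **monomial walk** of `(A, B)` is a sequence of vectors `w₀, w₁, …, w_L` such that at every step EITHER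
`A wₜ = wₜ₊₁, B wₜ = 0` (an `A`-step, weight `0`) OR `A wₜ = 0, B wₜ = wₜ₊₁` (a `B`-step, weight `1`).  Along such a walk the
line matrix acts monomially: `(A + s B)^L w₀ = s^{#B-steps} · w_L` (`pow_mulVec_of_monomialWalk`), so if `w_L ≠ 0` some entry of
`(A + sB)^L` has `s`-degree `≥ #B-steps` (`exists_le_totalDegree_of_mulVec_eq`).  Consequences in the stub's currency:

* ★ `weight_le_of_ledger` / `not_ledger_of_monomialWalk` — if `(K, k)` is a whole-pencil ledger, `v ∈ K`, and `(N(x), lin v)` admits a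
  monomial walk of length `L ≤ n − 1` with nonzero end vector, then its number of `lin v`-steps is `≤ k`.
* ★ `pow_mulVec_of_closedChain`, `mul_le_of_ledger_of_closedChain` — CLOSED CHAINS: if `lin v` has a chain
  `u_{q−1} ↦ u_{q−2} ↦ ⋯ ↦ u₀ ↦ 0` (`q ≥ 2`) which the point value CLOSES (`N(x) u₀ = u_{q−1}`, `N(x) uᵢ = 0` for `1 ≤ i < q`), then
  `(N(x) + s·lin v)^{jq} u₀ = s^{j(q−1)} u₀`, hence `j·(q − 1) ≤ k` whenever `j·q ≤ n − 1`: a direction of nil-index only `q` (as small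
  as `2`) is forced up to window order `≈ (n − 1)(q − 1)/q` by a single closing value.  WINDOW ≠ INDEX: the index shadow allows such a
  direction at order `k = q − 1`.

USE (memo `FIFTEENTH-HAND.md` on 24318/8062).  (i) The repeated-block pencils `S_ℓ ⊗ X` (`X` the generic `r × r` matrix; triangularisable!)
are WINDOW-FLAT: every nonzero direction `S_ℓ ⊗ X_D` is closed (helically) by a point `S_ℓ ⊗ X_P`, so no ledger of order `k < (ℓ − 3)/2` has a
nonzero direction although the index-`2` directions have dimension `⌊r²/4⌋`; (ii) violator shape for (c): a violator must be MASSIVE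
(`μ > c√n·b`) and WINDOW-FLAT up to order `c·b/√n` simultaneously; product families `S ⊗ M_r` have `μ · k_flat ≤ b²` and never are.
HONEST FRAMING.  An INSTRUMENT (`--supports stmt-ValiantsHypothesis-24318`); NOT progress on (c) `LongMassSlowLawInv` (RESEARCH — OPEN); closes
no stub; S3, 24318, 8062 (`stub_dualUnipotent`) and `VP ≠ VNP` are NOT proved.  Def-free, no named facts, no sorry. [folklore: weighted walks]
-/

set_option linter.dupNamespace false
set_option autoImplicit false

noncomputable section

namespace Summit.ValiantsHypothesis.ValiantsHypothesis.Theorems.GrenetZeon.MonomialWalk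

open MvPolynomial Matrix
open scoped BigOperators
open Summit.ValiantsHypothesis.ValiantsHypothesis.Cruxes.TwoDimCoefficients.DimTwoCases (AffMat IsAffine)
open Summit.ValiantsHypothesis.ValiantsHypothesis.Theorems.GrenetZeon.RadicalSplit (lineSubst)
open Summit.ValiantsHypothesis.ValiantsHypothesis.Theorems.GrenetZeon.SlowCore (Ledger)
open Summit.ValiantsHypothesis.ValiantsHypothesis.Theorems.GrenetZeon.ResolventFlag (linMat pointMat)

variable {m : ℕ}

/-! ## §1 The line matrix `A + s·B` acts on constant vectors -/

/-- `(A + s·B)·u = A u + s·(B u)` for a constant vector `u` (entries cast into `ℂ[s]`). [folklore] -/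
theorem lineMat_mulVec_C (A B : Matrix (Fin m) (Fin m) ℂ) (u : Fin m → ℂ) :
    (A.map (C : ℂ →+* MvPolynomial (Fin 1) ℂ) + (X 0 : MvPolynomial (Fin 1) ℂ) • B.map (C : ℂ →+* MvPolynomial (Fin 1) ℂ)) *ᵥ
        (fun i => C (u i)) =
      (fun i => C ((A *ᵥ u) i)) + (X 0 : MvPolynomial (Fin 1) ℂ) • (fun i => C ((B *ᵥ u) i)) := by
  rw [Matrix.add_mulVec, Matrix.smul_mulVec]
  congr 1
  · funext i
    exact (RingHom.map_mulVec (C : ℂ →+* MvPolynomial (Fin 1) ℂ) A u i).symm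
  · congr 1
    funext i
    exact (RingHom.map_mulVec (C : ℂ →+* MvPolynomial (Fin 1) ℂ) B u i).symm

/-- The zero vector casts to the zero vector. [folklore] -/
theorem cast_zero_vec : (fun i : Fin m => C ((0 : Fin m → ℂ) i) : Fin m → MvPolynomial (Fin 1) ℂ) = 0 := by
  funext i
  simp

/-! ## §2 Monomial walks -/

/-- ★ **MONOMIAL WALK.**  If `w₀, …, w_L` is a monomial walk of `(A, B)` — at each step `t < L` either `A wₜ = wₜ₊₁ ∧ B wₜ = 0`
(`ε t = 0`) or `A wₜ = 0 ∧ B wₜ = wₜ₊₁` (`ε t = 1`) — then `(A + s B)^L w₀ = s^{Σ ε} · w_L`. [folklore: weighted walks] -/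
theorem pow_mulVec_of_monomialWalk (A B : Matrix (Fin m) (Fin m) ℂ) (L : ℕ) (w : ℕ → Fin m → ℂ) (ε : ℕ → ℕ)
    (hstep : ∀ t, t < L →
      (ε t = 0 ∧ A *ᵥ w t = w (t + 1) ∧ B *ᵥ w t = 0) ∨ (ε t = 1 ∧ A *ᵥ w t = 0 ∧ B *ᵥ w t = w (t + 1))) :
    ((A.map (C : ℂ →+* MvPolynomial (Fin 1) ℂ) + (X 0 : MvPolynomial (Fin 1) ℂ) • B.map (C : ℂ →+* MvPolynomial (Fin 1) ℂ)) ^ L) *ᵥ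
        (fun i => C (w 0 i)) =
      (X 0 : MvPolynomial (Fin 1) ℂ) ^ (∑ t ∈ Finset.range L, ε t) • (fun i => C (w L i)) := by
  induction L generalizing w ε with
  | zero => simp
  | succ L ih =>
      set M := A.map (C : ℂ →+* MvPolynomial (Fin 1) ℂ) +
        (X 0 : MvPolynomial (Fin 1) ℂ) • B.map (C : ℂ →+* MvPolynomial (Fin 1) ℂ) with hM
      have hfirst : M *ᵥ (fun i => C (w 0 i)) = (X 0 : MvPolynomial (Fin 1) ℂ) ^ (ε 0) • (fun i => C (w 1 i)) := by
        rw [hM, lineMat_mulVec_C]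
        rcases hstep 0 (Nat.succ_pos L) with ⟨hε, hA, hB⟩ | ⟨hε, hA, hB⟩
        · rw [hA, hB, hε, pow_zero, one_smul, cast_zero_vec, smul_zero, add_zero]
        · rw [hA, hB, hε, pow_one, cast_zero_vec, zero_add]
      have hrest := ih (fun t => w (t + 1)) (fun t => ε (t + 1)) (fun t ht => hstep (t + 1) (Nat.succ_lt_succ ht))
      rw [pow_succ, ← Matrix.mulVec_mulVec, hfirst, Matrix.mulVec_smul, hrest, smul_smul, ← pow_add,
        Finset.sum_range_succ' ε L, add_comm (ε 0)]

/-- **Degree extraction.**  If `M a = s^e · c` for constant vectors `a`, `c` with `c i ≠ 0`, then some entry of row `i` of `M` has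
`s`-degree `≥ e`. [folklore] -/
theorem exists_le_totalDegree_of_mulVec_eq (M : Matrix (Fin m) (Fin m) (MvPolynomial (Fin 1) ℂ)) (a c : Fin m → ℂ) (e : ℕ)
    (h : M *ᵥ (fun i => C (a i)) = (X 0 : MvPolynomial (Fin 1) ℂ) ^ e • (fun i => C (c i))) (i : Fin m) (hi : c i ≠ 0) :
    ∃ j, e ≤ (M i j).totalDegree := by
  classical
  have hi' := congr_fun h i
  simp only [Matrix.mulVec, dotProduct, Pi.smul_apply, smul_eq_mul] at hi'
  have hR : coeff (Finsupp.single (0 : Fin 1) e) ((X 0 : MvPolynomial (Fin 1) ℂ) ^ e * C (c i)) = c i := by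
    rw [mul_comm, coeff_C_mul, coeff_X_pow, if_pos rfl, mul_one]
  have hcoeff := congr_arg (coeff (Finsupp.single (0 : Fin 1) e)) hi'
  rw [hR, coeff_sum] at hcoeff
  simp_rw [show ∀ j, M i j * C (a j) = C (a j) * M i j from fun j => mul_comm _ _, coeff_C_mul] at hcoeff
  have hne : ∑ j, a j * coeff (Finsupp.single (0 : Fin 1) e) (M i j) ≠ 0 := by rw [hcoeff]; exact hi
  obtain ⟨j, -, hj⟩ := Finset.exists_ne_zero_of_sum_ne_zero hne
  refine ⟨j, ?_⟩
  have hsupp : Finsupp.single (0 : Fin 1) e ∈ (M i j).support := by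
    rw [mem_support_iff]
    intro h0
    exact hj (by rw [h0, mul_zero])
  have := le_totalDegree hsupp
  rwa [Finsupp.sum_single_index rfl] at this

/-! ## §3 The ledger reading: walk weight ≤ window order -/

/-- Along a line the pencil is `N(x) + s·lin v` (✓ `CayleyTwist.map_lineSubst_eq`, in `pointMat` / `linMat` vocabulary). -/
theorem map_lineSubst_eq_pointMat {n : ℕ} (N : AffMat n m) (hN : IsAffine N) (x v : Fin n × Fin n → ℂ) :
    N.map (lineSubst x v) = (pointMat N x).map (C : ℂ →+* MvPolynomial (Fin 1) ℂ) +
      (X 0 : MvPolynomial (Fin 1) ℂ) • (linMat N v).map (C : ℂ →+* MvPolynomial (Fin 1) ℂ) :=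
  CayleyTwist.map_lineSubst_eq N hN x v

/-- ★ **WALK WEIGHT ≤ WINDOW ORDER.**  If `(K, k)` is a whole-pencil ledger of the affine pencil `N`, `v ∈ K`, and at the point `x` the pair
`(N(x), lin v)` admits a monomial walk of length `L ≤ n − 1` with nonzero end vector, then the walk uses `lin v` at most `k` times. -/
theorem weight_le_of_ledger {n : ℕ} (N : AffMat n m) (hN : IsAffine N) {K : Submodule ℂ (Fin n × Fin n → ℂ)} {k : ℕ}
    (hK : Ledger n m N (fun _ => True) K k) {x v : Fin n × Fin n → ℂ} (hv : v ∈ K) {L : ℕ} (hL : L ≤ n - 1)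
    (w : ℕ → Fin m → ℂ) (ε : ℕ → ℕ)
    (hstep : ∀ t, t < L →
      (ε t = 0 ∧ pointMat N x *ᵥ w t = w (t + 1) ∧ linMat N v *ᵥ w t = 0) ∨
        (ε t = 1 ∧ pointMat N x *ᵥ w t = 0 ∧ linMat N v *ᵥ w t = w (t + 1)))
    (hend : w L ≠ 0) :
    ∑ t ∈ Finset.range L, ε t ≤ k := by
  obtain ⟨i, hi⟩ := Function.ne_iff.mp hend
  have hwalk := pow_mulVec_of_monomialWalk (pointMat N x) (linMat N v) L w ε hstep
  rw [← map_lineSubst_eq_pointMat N hN x v] at hwalk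
  obtain ⟨j, hj⟩ := exists_le_totalDegree_of_mulVec_eq _ (w 0) (w L) _ hwalk i hi
  exact hj.trans (hK x v hv L hL i j trivial trivial)

/-- Contrapositive: a monomial walk of length `≤ n − 1`, nonzero end, and MORE than `k` uses of `lin v` kills every order-`k` ledger
containing `v`. -/
theorem not_ledger_of_monomialWalk {n : ℕ} (N : AffMat n m) (hN : IsAffine N) (K : Submodule ℂ (Fin n × Fin n → ℂ)) (k : ℕ)
    {x v : Fin n × Fin n → ℂ} (hv : v ∈ K) {L : ℕ} (hL : L ≤ n - 1) (w : ℕ → Fin m → ℂ) (ε : ℕ → ℕ)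
    (hstep : ∀ t, t < L →
      (ε t = 0 ∧ pointMat N x *ᵥ w t = w (t + 1) ∧ linMat N v *ᵥ w t = 0) ∨
        (ε t = 1 ∧ pointMat N x *ᵥ w t = 0 ∧ linMat N v *ᵥ w t = w (t + 1)))
    (hend : w L ≠ 0) (hk : k < ∑ t ∈ Finset.range L, ε t) :
    ¬ Ledger n m N (fun _ => True) K k :=
  fun hK => absurd (weight_le_of_ledger N hN hK hv hL w ε hstep hend) (not_le.mpr hk)

/-! ## §4 Closed chains -/

/-- ★ **ONE TURN OF A CLOSED CHAIN.**  If `B u₀ = 0`, `B u_{i+1} = u_i` (`i + 1 < q`), and `A` closes the chain (`A u₀ = u_{q−1}`, `A u_i = 0` for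
`1 ≤ i < q`, `q ≥ 2`), then `(A + sB)^q u₀ = s^{q−1} u₀`. [folklore: weighted cycle] -/
theorem pow_mulVec_of_closedChain (A B : Matrix (Fin m) (Fin m) ℂ) (q : ℕ) (hq : 2 ≤ q) (u : ℕ → Fin m → ℂ)
    (hB0 : B *ᵥ u 0 = 0) (hB : ∀ i, i + 1 < q → B *ᵥ u (i + 1) = u i)
    (hA0 : A *ᵥ u 0 = u (q - 1)) (hA : ∀ i, 1 ≤ i → i < q → A *ᵥ u i = 0) :
    ((A.map (C : ℂ →+* MvPolynomial (Fin 1) ℂ) + (X 0 : MvPolynomial (Fin 1) ℂ) • B.map (C : ℂ →+* MvPolynomial (Fin 1) ℂ)) ^ q) *ᵥ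
        (fun i => C (u 0 i)) =
      (X 0 : MvPolynomial (Fin 1) ℂ) ^ (q - 1) • (fun i => C (u 0 i)) := by
  -- the walk `u₀ →(A) u_{q-1} →(B) u_{q-2} →(B) ⋯ →(B) u₀`
  set w : ℕ → Fin m → ℂ := fun t => if t = 0 then u 0 else u (q - t) with hw
  set ε : ℕ → ℕ := fun t => if t = 0 then 0 else 1 with hε
  have hstep : ∀ t, t < q →
      (ε t = 0 ∧ A *ᵥ w t = w (t + 1) ∧ B *ᵥ w t = 0) ∨ (ε t = 1 ∧ A *ᵥ w t = 0 ∧ B *ᵥ w t = w (t + 1)) := by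
    intro t ht
    by_cases h0 : t = 0
    · subst h0
      left
      refine ⟨by simp [hε], ?_, by simpa [hw] using hB0⟩
      simp only [hw, if_pos rfl, if_neg (Nat.succ_ne_zero 0)]
      rw [hA0]
    · right
      refine ⟨by simp [hε, h0], ?_, ?_⟩
      · simp only [hw, if_neg h0]
        exact hA (q - t) (by omega) (by omega)
      · simp only [hw, if_neg h0, if_neg (Nat.succ_ne_zero t)]
        have h1 : q - t = (q - (t + 1)) + 1 := by omega
        rw [h1]
        exact hB (q - (t + 1)) (by omega)
  have hmain := pow_mulVec_of_monomialWalk A B q w ε hstep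
  have hw0 : w 0 = u 0 := by simp [hw]
  have hwq : w q = u 0 := by
    simp only [hw]
    by_cases h : q = 0
    · rw [if_pos h]
    · rw [if_neg h, Nat.sub_self]
  have hsum : ∑ t ∈ Finset.range q, ε t = q - 1 := by
    obtain ⟨q', rfl⟩ : ∃ q', q = q' + 1 := ⟨q - 1, by omega⟩
    rw [Finset.sum_range_succ']
    simp [hε]
  rw [hw0, hwq, hsum] at hmain
  exact hmain

/-- `j` turns of a closed chain: `(A + sB)^{j·q} u₀ = s^{j·(q−1)} u₀`. -/
theorem pow_mul_mulVec_of_closedChain (A B : Matrix (Fin m) (Fin m) ℂ) (q : ℕ) (hq : 2 ≤ q) (u : ℕ → Fin m → ℂ)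
    (hB0 : B *ᵥ u 0 = 0) (hB : ∀ i, i + 1 < q → B *ᵥ u (i + 1) = u i)
    (hA0 : A *ᵥ u 0 = u (q - 1)) (hA : ∀ i, 1 ≤ i → i < q → A *ᵥ u i = 0) (j : ℕ) :
    ((A.map (C : ℂ →+* MvPolynomial (Fin 1) ℂ) + (X 0 : MvPolynomial (Fin 1) ℂ) • B.map (C : ℂ →+* MvPolynomial (Fin 1) ℂ)) ^ (j * q)) *ᵥ
        (fun i => C (u 0 i)) =
      (X 0 : MvPolynomial (Fin 1) ℂ) ^ (j * (q - 1)) • (fun i => C (u 0 i)) := by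
  induction j with
  | zero => simp
  | succ j ih =>
      rw [Nat.succ_mul, pow_add, ← Matrix.mulVec_mulVec, pow_mulVec_of_closedChain A B q hq u hB0 hB hA0 hA,
        Matrix.mulVec_smul, ih, smul_smul, ← pow_add, Nat.succ_mul, add_comm]

/-- ★ **CLOSED CHAINS FORCE WINDOW ORDER.**  If `(K, k)` is a whole-pencil ledger of the affine pencil `N`, `v ∈ K`, and at some point `x`
the value `N(x)` closes a chain `u_{q−1} ↦ ⋯ ↦ u₀ ↦ 0` of `lin v` (`q ≥ 2`, `u₀ ≠ 0`), then `j·(q − 1) ≤ k` for every `j` with `j·q ≤ n − 1`.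
(The index shadow ✓ `linMat_pow_eq_zero_of_ledger` only sees `q − 1 ≤ k`.) -/
theorem mul_le_of_ledger_of_closedChain {n : ℕ} (N : AffMat n m) (hN : IsAffine N) {K : Submodule ℂ (Fin n × Fin n → ℂ)} {k : ℕ}
    (hK : Ledger n m N (fun _ => True) K k) {x v : Fin n × Fin n → ℂ} (hv : v ∈ K) (q : ℕ) (hq : 2 ≤ q) (u : ℕ → Fin m → ℂ)
    (hu0 : u 0 ≠ 0) (hB0 : linMat N v *ᵥ u 0 = 0) (hB : ∀ i, i + 1 < q → linMat N v *ᵥ u (i + 1) = u i)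
    (hA0 : pointMat N x *ᵥ u 0 = u (q - 1)) (hA : ∀ i, 1 ≤ i → i < q → pointMat N x *ᵥ u i = 0)
    (j : ℕ) (hj : j * q ≤ n - 1) :
    j * (q - 1) ≤ k := by
  obtain ⟨i, hi⟩ := Function.ne_iff.mp hu0
  have hturn := pow_mul_mulVec_of_closedChain (pointMat N x) (linMat N v) q hq u hB0 hB hA0 hA j
  rw [← map_lineSubst_eq_pointMat N hN x v] at hturn
  obtain ⟨j', hj'⟩ := exists_le_totalDegree_of_mulVec_eq _ (u 0) (u 0) _ hturn i hi
  exact hj'.trans (hK x v hv (j * q) hj i j' trivial trivial)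

/-- Price form: such a direction `v` can only sit in certificates of order `k ≥ j·(q−1)`; in particular (taking the largest `j`) an order-`k`
whole-pencil ledger containing `v` needs `(q − 1)·((n − 1) / q) ≤ k`. -/
theorem div_mul_le_of_ledger_of_closedChain {n : ℕ} (N : AffMat n m) (hN : IsAffine N) {K : Submodule ℂ (Fin n × Fin n → ℂ)} {k : ℕ}
    (hK : Ledger n m N (fun _ => True) K k) {x v : Fin n × Fin n → ℂ} (hv : v ∈ K) (q : ℕ) (hq : 2 ≤ q) (u : ℕ → Fin m → ℂ)
    (hu0 : u 0 ≠ 0) (hB0 : linMat N v *ᵥ u 0 = 0) (hB : ∀ i, i + 1 < q → linMat N v *ᵥ u (i + 1) = u i)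
    (hA0 : pointMat N x *ᵥ u 0 = u (q - 1)) (hA : ∀ i, 1 ≤ i → i < q → pointMat N x *ᵥ u i = 0) :
    ((n - 1) / q) * (q - 1) ≤ k :=
  mul_le_of_ledger_of_closedChain N hN hK hv q hq u hu0 hB0 hB hA0 hA ((n - 1) / q) (Nat.div_mul_le_self (n - 1) q)

/-! ## §5 By-name shadows: certificates and the stub (c) -/

/-- **CLOSED-CHAIN SHADOW OF A CERTIFICATE.**  A whole-pencil certificate of price `P` (✓ `SlowCore.RelCert`) consists of directions none of which is
closed into a chain of length `q` by any value of the pencil unless `((n − 1)/q)·(q − 1) ≤ k`; pluggable lower-bound form (compare the index shadow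
✓ `LedgerIndex.exists_indexShadow_of_relCert`, which is the case "no closing value needed, `q − 1 ≤ k`"). -/
theorem exists_closedChainShadow_of_relCert {n : ℕ} (N : AffMat n m) (hN : IsAffine N) {P : ℕ}
    (h : SlowCore.RelCert n m N P) :
    ∃ (K : Submodule ℂ (Fin n × Fin n → ℂ)) (k : ℕ), n * k + (n * n - Module.finrank ℂ K) ≤ P ∧
      ∀ v ∈ K, ∀ (x : Fin n × Fin n → ℂ) (q : ℕ), 2 ≤ q → ∀ u : ℕ → Fin m → ℂ, u 0 ≠ 0 →
        linMat N v *ᵥ u 0 = 0 → (∀ i, i + 1 < q → linMat N v *ᵥ u (i + 1) = u i) →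
        pointMat N x *ᵥ u 0 = u (q - 1) → (∀ i, 1 ≤ i → i < q → pointMat N x *ᵥ u i = 0) →
        ((n - 1) / q) * (q - 1) ≤ k := by
  obtain ⟨K, k, hK, hprice⟩ := h
  exact ⟨K, k, hprice, fun v hv x q hq u hu0 hB0 hB hA0 hA =>
    div_mul_le_of_ledger_of_closedChain N hN hK hv q hq u hu0 hB0 hB hA0 hA⟩

/-- **CLOSED-CHAIN SHADOW OF THE STUB (c)** (by name, ✓ `SlowCore.LongMassSlowLawInv`): (c) ⟹ every `IrreducibleInv` nilpotent affine pencil has a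
direction space `K` and an order `k` of price `n·k + codim K ≤ c·√n·b` in which no direction is closed into a `q`-chain by a value of the pencil unless
`((n − 1)/q)·(q − 1) ≤ k`.  (A (c)-violator may therefore be certified by exhibiting, for every cheap `K`, ONE direction and ONE closing value.)
NOT progress on (c). -/
theorem closedChainShadow_of_longMassSlowLawInv (h : SlowCore.LongMassSlowLawInv) :
    ∃ c n₀ : ℕ, ∀ n ≥ n₀, ∀ b : ℕ, ∀ B : AffMat n b, IsAffine B → B ^ b = 0 → SlowCore.IrreducibleInv B →
      ∃ (K : Submodule ℂ (Fin n × Fin n → ℂ)) (k : ℕ), n * k + (n * n - Module.finrank ℂ K) ≤ c * (Nat.sqrt n * b) ∧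
        ∀ v ∈ K, ∀ (x : Fin n × Fin n → ℂ) (q : ℕ), 2 ≤ q → ∀ u : ℕ → Fin b → ℂ, u 0 ≠ 0 →
          linMat B v *ᵥ u 0 = 0 → (∀ i, i + 1 < q → linMat B v *ᵥ u (i + 1) = u i) →
          pointMat B x *ᵥ u 0 = u (q - 1) → (∀ i, 1 ≤ i → i < q → pointMat B x *ᵥ u i = 0) →
          ((n - 1) / q) * (q - 1) ≤ k := by
  obtain ⟨c, n₀, h⟩ := h
  exact ⟨c, n₀, fun n hn b B hB hnil hirr => exists_closedChainShadow_of_relCert B hB (h n hn b B hB hnil hirr)⟩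

end Summit.ValiantsHypothesis.ValiantsHypothesis.Theorems.GrenetZeon.MonomialWalk

end
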